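import Summits.Parity.GeneralizedHardyLittlewood.Theorems.PrimeLevelFamEdgeMomentsBeyondDiagonalDiagRemAssembly
import Mathlib.Data.Finset.NatDivisors
import HarnessLib

/-!
# Route `PrimeLevelFamEdge`, crux K_A `MomentsBeyondDiagonal` (stmt-Parity-20007), line «petersson_layers» v4, stub `stub_diag`:
# **the `Σ_cΣ_g` bookkeeping of the order-`(2,2)` remainder estimate (R₂₂) with the SQUARED divisor weight** (brick B5a)

Brick B5a of (R₂₂) (the hypothesis `hR₂₂` of `…DiagRungTwoOfR22.diagPart_asymp_of_natDegree_le_two_of_remainder`, p830190).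
The inner estimate of order `(2,2)` (`…DiagRemTwoTwoInner`) is `≤ C·D(n)²·Λ¹²·(…)` — the square `D(n)²` of K_B's divisor weight
`D(n) = Σ_{d∣n} d^{−3/4}` comes from the both-sided monomial (`c_n² ≍ D(n)²`). The order-`(1,1)` bookkeeping
`…DiagRemAssembly.per_term_bound` / `…Corner.sum_sum_divWeight_div_mul(_sq)_le` is redone for a general weight `w` and for
`w = D²`: sub-multiplicativity `D(mn) ≤ D(m)D(n)`, `Σ_{g≤N} D(g)²/g² ≤ 3Z₂` (Abel from `Σ_{g≤t}D² ≤ Z₂t`), hence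
`Σ_cΣ_g D(cg)²/(cg) ≤ (Z₂(2+log N))²` and `Σ_cΣ_g D(cg)²/(cg²) ≤ 3Z₂²(2+log N)` — ONE logarithm, as the budget of (R₂₂) requires.

* `divWeight_mul_le` — `D(mn) ≤ D(m)·D(n)`;
* `sum_divWeight_sq_div_sq_le` — `Σ_{g≤N} D(g)²/g² ≤ 3Z₂`;
* `sum_sum_divWeightSq_div_mul_le`, `sum_sum_divWeightSq_div_mul_sq_le` — the two double sums;
* `per_term_bound_gen` — one `(c,g)` term, both threshold regimes, general weight `w` and envelope factor `E`;
* `final_arith₂₂` — the closing arithmetic `C·Λ¹²·((Z₂(2+l))²A₁ + 3Z₂²(2+l)A₂) ≤ C·Z₂²(16·5¹⁴C₈ + 6·4¹²5¹³)·L`.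

Def-free; theorems only. Helper `--supports stmt-Parity-20007`; closes nothing; K_A, K_B and the Parity summit are NOT proved;
nothing about Landau–Siegel zeros.

## References
* E. Kowalski, P. Michel, J. VanderKam, J. reine angew. Math. 526 (2000), (22)–(28) pp. 12–15 and Prop. 5.1 p. 18.
  [cite: KowalskiMichelVanderKam2000, Prop. 5.1 — derivation (corner bookkeeping, order (2,2))]
-/

noncomputable section

open scoped Real ArithmeticFunction.Moebius Pointwise
open Finset ArithmeticFunction Real

namespace Summit.Parity.GeneralizedHardyLittlewood.Theorems.MomentsBeyondDiagonal.DiagCorner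

open Literature.NumberTheory.LFunctions Literature.NumberTheory.LFunctions.KMV2000
open MollifierMainTerm (W)
open Literature.Barriers.Parity (Icc_one_eq_Ioc_zero)
open Summit.Parity.GeneralizedHardyLittlewood.Theorems.BeyondDiagonalBeatsQuarter.KernelFormXSq
  (divWeight divWeight_nonneg one_le_divWeight abs_W_le sum_divWeight_sq_le sum_divWeight_sq_div_le sum_Ioc_mul_eq_abel)
open Summit.Parity.GeneralizedHardyLittlewood.Theorems.BeyondDiagonalBeatsQuarter.Corner

/-! ### The squared divisor weight -/

/-- **Sub-multiplicativity `D(mn) ≤ D(m)·D(n)`** (every divisor of `mn` is a product `d₁d₂`, `d₁ ∣ m`, `d₂ ∣ n`). [folklore] -/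
theorem divWeight_mul_le (m n : ℕ) : divWeight (m * n) ≤ divWeight m * divWeight n := by
  unfold divWeight
  rw [Nat.divisors_mul, Finset.mul_def, Finset.sum_mul_sum, ← Finset.sum_product']
  refine (Finset.sum_image_le_of_nonneg fun u _ ↦ by positivity).trans (le_of_eq ?_)
  refine Finset.sum_congr rfl fun p hp ↦ ?_
  rw [Finset.mem_product] at hp
  have h1 : (0 : ℝ) ≤ p.1 := Nat.cast_nonneg _
  have h2 : (0 : ℝ) ≤ p.2 := Nat.cast_nonneg _
  push_cast
  exact Real.mul_rpow h1 h2

/-- `Σ_{e ≤ N} (1/e − 1/(e+1)) = 1 − 1/(N+1)`. [folklore] -/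
theorem sum_Ioc_inv_sub_inv_succ (N : ℕ) :
    ∑ e ∈ Ioc 0 N, (((e : ℝ))⁻¹ - (((e + 1 : ℕ) : ℝ))⁻¹) = 1 - (((N + 1 : ℕ) : ℝ))⁻¹ := by
  induction N with
  | zero => simp
  | succ N ih =>
    rw [Finset.sum_Ioc_succ_top (Nat.zero_le N), ih]
    push_cast
    ring

/-- **`Σ_{g≤N} D(g)²/g² ≤ 3Z₂`** (Abel summation from `Σ_{g≤t} D(g)² ≤ Z₂t`). [folklore] -/
theorem sum_divWeight_sq_div_sq_le (N : ℕ) :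
    ∑ g ∈ Icc 1 N, divWeight g ^ 2 / (g : ℝ) ^ 2 ≤ 3 * (∑' d : ℕ, (d : ℝ) ^ (-(5 / 4 : ℝ))) ^ 2 := by
  set Z : ℝ := (∑' d : ℕ, (d : ℝ) ^ (-(5 / 4 : ℝ))) ^ 2 with hZ
  have hZ0 : 0 ≤ Z := sq_nonneg _
  have hA : ∀ t : ℕ, ∑ n ∈ Icc 1 t, divWeight n ^ 2 ≤ Z * t := sum_divWeight_sq_le
  rw [Icc_one_eq_Ioc_zero]
  have hre : ∑ e ∈ Ioc 0 N, divWeight e ^ 2 / (e : ℝ) ^ 2 =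
      ∑ e ∈ Ioc 0 N, divWeight e ^ 2 * (((e : ℝ) ^ 2))⁻¹ := Finset.sum_congr rfl fun e _ ↦ div_eq_mul_inv _ _
  rw [hre, sum_Ioc_mul_eq_abel (fun n ↦ divWeight n ^ 2) (fun n ↦ (((n : ℝ) ^ 2))⁻¹) (Nat.zero_le N)]
  -- interior terms
  have h1 : ∑ e ∈ Ioc 0 N, (∑ k ∈ Icc 1 e, divWeight k ^ 2) * ((((e : ℝ) ^ 2))⁻¹ - ((((e + 1 : ℕ) : ℝ) ^ 2))⁻¹) ≤
      ∑ e ∈ Ioc 0 N, 2 * Z * (((e : ℝ))⁻¹ - (((e + 1 : ℕ) : ℝ))⁻¹) := by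
    refine Finset.sum_le_sum fun e he ↦ ?_
    have he0 : (0 : ℝ) < e := by exact_mod_cast (Finset.mem_Ioc.1 he).1
    have he1 : (1 : ℝ) ≤ e := by exact_mod_cast (Finset.mem_Ioc.1 he).1
    have hdiff : (((e : ℝ) ^ 2))⁻¹ - ((((e + 1 : ℕ) : ℝ) ^ 2))⁻¹ = (2 * e + 1) / ((e : ℝ) ^ 2 * ((e : ℝ) + 1) ^ 2) := by
      push_cast; field_simp; ring
    have hdiff' : ((e : ℝ))⁻¹ - (((e + 1 : ℕ) : ℝ))⁻¹ = 1 / ((e : ℝ) * ((e : ℝ) + 1)) := by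
      push_cast; field_simp; ring
    rw [hdiff, hdiff']
    have hpos : 0 ≤ (2 * e + 1) / ((e : ℝ) ^ 2 * ((e : ℝ) + 1) ^ 2) := by positivity
    calc (∑ k ∈ Icc 1 e, divWeight k ^ 2) * ((2 * e + 1) / ((e : ℝ) ^ 2 * ((e : ℝ) + 1) ^ 2))
        ≤ Z * e * ((2 * e + 1) / ((e : ℝ) ^ 2 * ((e : ℝ) + 1) ^ 2)) := mul_le_mul_of_nonneg_right (hA e) hpos
      _ = Z * ((2 * e + 1) / ((e : ℝ) * ((e : ℝ) + 1) ^ 2)) := by field_simp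
      _ ≤ Z * (2 / ((e : ℝ) * ((e : ℝ) + 1))) := by
          apply mul_le_mul_of_nonneg_left _ hZ0
          rw [div_le_div_iff₀ (by positivity) (by positivity)]
          nlinarith
      _ = 2 * Z * (1 / ((e : ℝ) * ((e : ℝ) + 1))) := by ring
  have h2 : (∑ k ∈ Icc 1 N, divWeight k ^ 2) * ((((N + 1 : ℕ) : ℝ) ^ 2))⁻¹ ≤ Z := by
    have hN0 : (0 : ℝ) < ((N + 1 : ℕ) : ℝ) := by positivity
    rw [← div_eq_mul_inv, div_le_iff₀ (by positivity)]
    refine (hA N).trans ?_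
    push_cast; nlinarith [sq_nonneg (N : ℝ)]
  have hsumZero : (∑ k ∈ Icc 1 0, divWeight k ^ 2) = 0 := by simp
  rw [hsumZero, zero_mul, sub_zero]
  have h3 : ∑ e ∈ Ioc 0 N, 2 * Z * (((e : ℝ))⁻¹ - (((e + 1 : ℕ) : ℝ))⁻¹) ≤ 2 * Z := by
    rw [← Finset.mul_sum, sum_Ioc_inv_sub_inv_succ]
    have : 0 ≤ (((N + 1 : ℕ) : ℝ))⁻¹ := by positivity
    nlinarith
  linarith [h1, h2, h3]

/-- **`Σ_{c≤N}Σ_{g≤N/c} D(cg)²/(cg) ≤ (Z₂(2+log N))²`** (`N ≥ 1`). [folklore] -/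
theorem sum_sum_divWeightSq_div_mul_le {N : ℕ} (hN : 1 ≤ N) :
    ∑ c ∈ Icc 1 N, ∑ g ∈ Icc 1 (N / c), divWeight (c * g) ^ 2 / ((c : ℝ) * g) ≤
      ((∑' d : ℕ, (d : ℝ) ^ (-(5 / 4 : ℝ))) ^ 2 * (2 + Real.log N)) ^ 2 := by
  set Z : ℝ := (∑' d : ℕ, (d : ℝ) ^ (-(5 / 4 : ℝ))) ^ 2 with hZ
  have hS := sum_divWeight_sq_div_le hN
  have hS0 : 0 ≤ ∑ g ∈ Icc 1 N, divWeight g ^ 2 / g := Finset.sum_nonneg fun g _ ↦ by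
    have := divWeight_nonneg g; positivity
  have hterm : ∀ c ∈ Icc 1 N, ∑ g ∈ Icc 1 (N / c), divWeight (c * g) ^ 2 / ((c : ℝ) * g) ≤
      divWeight c ^ 2 / c * ∑ g ∈ Icc 1 N, divWeight g ^ 2 / g := by
    intro c hc
    have hc0 : (0 : ℝ) < c := by exact_mod_cast (Finset.mem_Icc.1 hc).1
    rw [Finset.mul_sum]
    refine (Finset.sum_le_sum_of_subset_of_nonneg (Finset.Icc_subset_Icc_right (Nat.div_le_self N c))
      fun g _ _ ↦ by have := divWeight_nonneg (c * g); positivity).trans (Finset.sum_le_sum fun g hg ↦ ?_)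
    have hg0 : (0 : ℝ) < g := by exact_mod_cast (Finset.mem_Icc.1 hg).1
    have hmul := divWeight_mul_le c g
    have hsq : divWeight (c * g) ^ 2 ≤ (divWeight c * divWeight g) ^ 2 :=
      pow_le_pow_left₀ (divWeight_nonneg _) hmul 2
    calc divWeight (c * g) ^ 2 / ((c : ℝ) * g) ≤ (divWeight c * divWeight g) ^ 2 / ((c : ℝ) * g) :=
          div_le_div_of_nonneg_right hsq (by positivity)
      _ = divWeight c ^ 2 / c * (divWeight g ^ 2 / g) := by field_simp
  calc _ ≤ ∑ c ∈ Icc 1 N, divWeight c ^ 2 / c * ∑ g ∈ Icc 1 N, divWeight g ^ 2 / g := Finset.sum_le_sum hterm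
    _ = (∑ c ∈ Icc 1 N, divWeight c ^ 2 / c) * ∑ g ∈ Icc 1 N, divWeight g ^ 2 / g := by rw [Finset.sum_mul]
    _ ≤ (Z * (2 + Real.log N)) * (Z * (2 + Real.log N)) := mul_le_mul hS hS hS0 (hS0.trans hS)
    _ = (Z * (2 + Real.log N)) ^ 2 := by ring

/-- **`Σ_{c≤N}Σ_{g≤N/c} D(cg)²/(cg²) ≤ 3Z₂²(2+log N)`** (`N ≥ 1`). [folklore] -/
theorem sum_sum_divWeightSq_div_mul_sq_le {N : ℕ} (hN : 1 ≤ N) :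
    ∑ c ∈ Icc 1 N, ∑ g ∈ Icc 1 (N / c), divWeight (c * g) ^ 2 / ((c : ℝ) * g ^ 2) ≤
      3 * ((∑' d : ℕ, (d : ℝ) ^ (-(5 / 4 : ℝ))) ^ 2) ^ 2 * (2 + Real.log N) := by
  set Z : ℝ := (∑' d : ℕ, (d : ℝ) ^ (-(5 / 4 : ℝ))) ^ 2 with hZ
  have hZ0 : 0 ≤ Z := sq_nonneg _
  have hS := sum_divWeight_sq_div_le hN
  have hT := sum_divWeight_sq_div_sq_le N
  have hT0 : 0 ≤ ∑ g ∈ Icc 1 N, divWeight g ^ 2 / (g : ℝ) ^ 2 := Finset.sum_nonneg fun g _ ↦ by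
    have := divWeight_nonneg g; positivity
  have hS0 : 0 ≤ ∑ g ∈ Icc 1 N, divWeight g ^ 2 / g := Finset.sum_nonneg fun g _ ↦ by
    have := divWeight_nonneg g; positivity
  have hterm : ∀ c ∈ Icc 1 N, ∑ g ∈ Icc 1 (N / c), divWeight (c * g) ^ 2 / ((c : ℝ) * g ^ 2) ≤
      divWeight c ^ 2 / c * ∑ g ∈ Icc 1 N, divWeight g ^ 2 / (g : ℝ) ^ 2 := by
    intro c hc
    have hc0 : (0 : ℝ) < c := by exact_mod_cast (Finset.mem_Icc.1 hc).1
    rw [Finset.mul_sum]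
    refine (Finset.sum_le_sum_of_subset_of_nonneg (Finset.Icc_subset_Icc_right (Nat.div_le_self N c))
      fun g _ _ ↦ by have := divWeight_nonneg (c * g); positivity).trans (Finset.sum_le_sum fun g hg ↦ ?_)
    have hg0 : (0 : ℝ) < g := by exact_mod_cast (Finset.mem_Icc.1 hg).1
    have hsq : divWeight (c * g) ^ 2 ≤ (divWeight c * divWeight g) ^ 2 :=
      pow_le_pow_left₀ (divWeight_nonneg _) (divWeight_mul_le c g) 2
    calc divWeight (c * g) ^ 2 / ((c : ℝ) * g ^ 2) ≤ (divWeight c * divWeight g) ^ 2 / ((c : ℝ) * g ^ 2) :=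
          div_le_div_of_nonneg_right hsq (by positivity)
      _ = divWeight c ^ 2 / c * (divWeight g ^ 2 / (g : ℝ) ^ 2) := by field_simp
  calc _ ≤ ∑ c ∈ Icc 1 N, divWeight c ^ 2 / c * ∑ g ∈ Icc 1 N, divWeight g ^ 2 / (g : ℝ) ^ 2 :=
        Finset.sum_le_sum hterm
    _ = (∑ c ∈ Icc 1 N, divWeight c ^ 2 / c) * ∑ g ∈ Icc 1 N, divWeight g ^ 2 / (g : ℝ) ^ 2 := by
        rw [Finset.sum_mul]
    _ ≤ (Z * (2 + Real.log N)) * (3 * Z) := mul_le_mul hS hT hT0 (hS0.trans hS)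
    _ = 3 * Z ^ 2 * (2 + Real.log N) := by ring

/-! ### One `(c,g)` term, general weight -/

/-- **One `(c,g)` term, both threshold regimes, for a general weight `w ≥ 0` and envelope factor `E ≥ 0`**: if
`|F(n,g)| ≤ C·w(n)·(E√(2(g²/Q²)K(M/n)) + E/(1+log K)¹²)` for every admissible threshold `K`, then for ANY `K₁`
`|μ(g)·c·(W(cg)²F(cg,g))| ≤ CE·(w(cg)/(cg)·(√(2K₁M)/Q + 2K₁M/Q²) + w(cg)/(cg²)·(1+log K₁)⁻¹²)` (the order-`(1,1)`
`…DiagRemAssembly.per_term_bound` is `w = D`, `E = Λ¹⁰`). [cite: KowalskiMichelVanderKam2000, Prop. 5.1 — derivation (corner bookkeeping)] -/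
theorem per_term_bound_gen {F : ℕ → ℕ → ℝ} {w : ℕ → ℝ} {C E Q M : ℝ} (hC : 0 ≤ C) (hE : 0 ≤ E)
    (hw : ∀ n, 0 ≤ w n) (hQ : 0 < Q) (hM : 1 ≤ M)
    (hF : ∀ n g : ℕ, n ≠ 0 → g ≠ 0 → (n : ℝ) ≤ M → (g : ℝ) ≤ M → ∀ K : ℕ,
      2 * ((g : ℝ) ^ 2 / Q ^ 2) * K * (M / n) ≤ 1 →
      |F n g| ≤ C * w n *
        (E * Real.sqrt (2 * ((g : ℝ) ^ 2 / Q ^ 2) * K * (M / n)) + E / (1 + Real.log K) ^ 12))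
    (K₁ : ℕ) {c g : ℕ} (hc : c ∈ Icc 1 ⌊M⌋₊) (hg : g ∈ Icc 1 (⌊M⌋₊ / c)) :
    |(μ g : ℝ) * c * (W (c * g) ^ 2 * F (c * g) g)| ≤
      C * E * (w (c * g) / ((c : ℝ) * g) * (Real.sqrt (2 * K₁ * M) / Q + 2 * K₁ * M / Q ^ 2) +
        w (c * g) / ((c : ℝ) * g ^ 2) * (1 / (1 + Real.log K₁) ^ 12)) := by
  rw [show (μ g : ℝ) * c * (W (c * g) ^ 2 * F (c * g) g) = (μ g : ℝ) * c * W (c * g) ^ 2 * F (c * g) g by ring]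
  have hM0 : 0 < M := by linarith
  set N : ℕ := ⌊M⌋₊ with hNdef
  have hNM : (N : ℝ) ≤ M := Nat.floor_le hM0.le
  have hc1 := (Finset.mem_Icc.1 hc).1
  have hg1 := (Finset.mem_Icc.1 hg).1
  have hc0 : (0 : ℝ) < c := by exact_mod_cast hc1
  have hgr : (0 : ℝ) < g := by exact_mod_cast hg1
  have hc1r : (1 : ℝ) ≤ c := by exact_mod_cast hc1
  have hg1r : (1 : ℝ) ≤ g := by exact_mod_cast hg1
  have hcg0 : c * g ≠ 0 := by positivity
  have hnN : c * g ≤ N := by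
    have := (Finset.mem_Icc.1 hg).2
    calc c * g ≤ c * (N / c) := Nat.mul_le_mul_left c this
      _ ≤ N := Nat.mul_div_le N c
  have hnM : ((c * g : ℕ) : ℝ) ≤ M := le_trans (by exact_mod_cast hnN) hNM
  have hgN : g ≤ N := (Finset.mem_Icc.1 hg).2.trans (Nat.div_le_self N c)
  have hgM : (g : ℝ) ≤ M := le_trans (by exact_mod_cast hgN) hNM
  have hD := hw (c * g)
  have hK0 : (0 : ℝ) ≤ K₁ := Nat.cast_nonneg _
  have hlogK : 0 ≤ Real.log (K₁ : ℝ) := Real.log_natCast_nonneg K₁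
  have hLam10 : 0 ≤ E := hE
  -- the atoms `u = 1/(cg)`, `v = 1/(cg²)`, `S₁ = √(2K₁M)/Q`, `L₁ = 2K₁M/Q²`, `T = (1+log K₁)⁻¹²`
  set u : ℝ := 1 / ((c : ℝ) * g) with hu
  set v : ℝ := 1 / ((c : ℝ) * g ^ 2) with hv
  set S₁ : ℝ := Real.sqrt (2 * K₁ * M) / Q with hS₁
  set L₁ : ℝ := 2 * K₁ * M / Q ^ 2 with hL₁
  set T : ℝ := 1 / (1 + Real.log (K₁ : ℝ)) ^ 12 with hT
  have hu0 : 0 ≤ u := by positivity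
  have hv0 : 0 ≤ v := by positivity
  have hS0 : 0 ≤ S₁ := by positivity
  have hL0 : 0 ≤ L₁ := by positivity
  have hT0 : 0 ≤ T := by positivity
  have huv : v * g = u := by rw [hu, hv]; field_simp
  have hvu : v ≤ u := by
    rw [← huv]
    have : v * 1 ≤ v * g := mul_le_mul_of_nonneg_left hg1r hv0
    linarith
  rw [div_eq_mul_one_div (w (c * g)) ((c : ℝ) * g), div_eq_mul_one_div (w (c * g)) ((c : ℝ) * g ^ 2)]
  -- |μ g · c · W(n)²| ≤ v
  have hW : W (c * g) ^ 2 ≤ (((c * g : ℕ) : ℝ))⁻¹ ^ 2 := by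
    rw [← sq_abs]; exact pow_le_pow_left₀ (abs_nonneg _) (abs_W_le (c * g)) 2
  have hμ : |(μ g : ℝ)| ≤ 1 := by exact_mod_cast ArithmeticFunction.abs_moebius_le_one
  have hcoef : |(μ g : ℝ) * c * W (c * g) ^ 2| ≤ v := by
    rw [abs_mul, abs_mul, abs_of_pos hc0, abs_of_nonneg (sq_nonneg (W (c * g)))]
    calc |(μ g : ℝ)| * c * W (c * g) ^ 2 ≤ 1 * c * (((c * g : ℕ) : ℝ))⁻¹ ^ 2 := by gcongr
      _ = v := by rw [hv]; push_cast; field_simp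
  rw [abs_mul]
  by_cases hA : 2 * ((g : ℝ) ^ 2 / Q ^ 2) * K₁ * (M / ((c * g : ℕ) : ℝ)) ≤ 1
  · -- regime A: threshold K₁
    have h := hF (c * g) g hcg0 (by omega) hnM hgM K₁ hA
    have hsqrt : Real.sqrt (2 * ((g : ℝ) ^ 2 / Q ^ 2) * K₁ * (M / ((c * g : ℕ) : ℝ))) ≤ g * S₁ := by
      have h1 : 2 * ((g : ℝ) ^ 2 / Q ^ 2) * K₁ * (M / ((c * g : ℕ) : ℝ)) ≤ (g * S₁) ^ 2 := by
        rw [hS₁, mul_pow, div_pow, Real.sq_sqrt (by positivity)]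
        have e : 2 * ((g : ℝ) ^ 2 / Q ^ 2) * K₁ * (M / ((c * g : ℕ) : ℝ)) =
            (g : ℝ) ^ 2 * (2 * K₁ * M / Q ^ 2) * u := by
          rw [hu]; push_cast; field_simp
        rw [e]
        have hu1 : u ≤ 1 := by
          rw [hu, div_le_one (by positivity)]; nlinarith
        have : 0 ≤ (g : ℝ) ^ 2 * (2 * K₁ * M / Q ^ 2) := by positivity
        nlinarith
      calc _ ≤ Real.sqrt ((g * S₁) ^ 2) := Real.sqrt_le_sqrt h1
        _ = g * S₁ := Real.sqrt_sq (by positivity)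
    have h' : |F (c * g) g| ≤ C * w (c * g) * (E * (g * S₁ + T)) := by
      refine h.trans (mul_le_mul_of_nonneg_left ?_ (by positivity))
      rw [div_eq_mul_one_div (E)]
      calc E * Real.sqrt (2 * ((g : ℝ) ^ 2 / Q ^ 2) * K₁ * (M / ((c * g : ℕ) : ℝ))) + E * T
          ≤ E * (g * S₁) + E * T := by gcongr
        _ = E * (g * S₁ + T) := by ring
    calc |(μ g : ℝ) * c * W (c * g) ^ 2| * |F (c * g) g|
        ≤ v * (C * w (c * g) * (E * (g * S₁ + T))) := mul_le_mul hcoef h' (abs_nonneg _) hv0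
      _ = C * E * (w (c * g) * (v * g) * S₁ + w (c * g) * v * T) := by ring
      _ = C * E * (w (c * g) * u * S₁ + w (c * g) * v * T) := by rw [huv]
      _ ≤ C * E * (w (c * g) * u * (S₁ + L₁) + w (c * g) * v * T) := by
          gcongr
          exact le_add_of_nonneg_right hL0
  · -- regime B: threshold 0; `1/g < 2K₁M/(cQ²) ≤ 2K₁M/Q²`
    rw [not_le] at hA
    have h := hF (c * g) g hcg0 (by omega) hnM hgM 0 (by simp)
    simp only [Nat.cast_zero, mul_zero, zero_mul, Real.sqrt_zero, Real.log_zero, add_zero, one_pow, div_one,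
      zero_add] at h
    -- `v ≤ u · L₁`
    have hA' : 1 < L₁ * ((g : ℝ) / c) := by
      have e : 2 * ((g : ℝ) ^ 2 / Q ^ 2) * K₁ * (M / ((c * g : ℕ) : ℝ)) = L₁ * ((g : ℝ) / c) := by
        rw [hL₁]; push_cast; field_simp
      exact lt_of_lt_of_eq hA e
    have hgc : (g : ℝ) / c ≤ g := div_le_self hgr.le hc1r
    have h1 : 1 ≤ L₁ * g := by
      have := mul_le_mul_of_nonneg_left hgc hL0
      linarith
    have hginv : v ≤ u * L₁ := by
      rw [← huv]
      have : v * 1 ≤ v * (L₁ * g) := mul_le_mul_of_nonneg_left h1 hv0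
      linarith
    calc |(μ g : ℝ) * c * W (c * g) ^ 2| * |F (c * g) g|
        ≤ v * (C * w (c * g) * E) := mul_le_mul hcoef h (abs_nonneg _) hv0
      _ = C * E * w (c * g) * v := by ring
      _ ≤ C * E * w (c * g) * (u * L₁) := mul_le_mul_of_nonneg_left hginv (by positivity)
      _ ≤ C * E * (w (c * g) * u * (S₁ + L₁) + w (c * g) * v * T) := by
          have e : C * E * w (c * g) * (u * L₁) = C * E * (w (c * g) * u * L₁) := by ring
          rw [e]
          apply mul_le_mul_of_nonneg_left _ (by positivity)
          linarith [mul_nonneg (mul_nonneg hD hu0) hS0, mul_nonneg (mul_nonneg hD hv0) hT0]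


/-! ### The closing arithmetic -/

/-- The closing arithmetic of (R₂₂): `CΛ¹²((Z(2+l))²A₁ + 3Z²(2+l)A₂) ≤ C·Z²(16·5¹⁴C₈ + 6·4¹²5¹³)·L` from
`A₁ ≤ 4C₈/(1+L)¹⁵`, `A₂ ≤ 4¹²/L¹²`, `2 + l ≤ 2Λ`, `1 ≤ Λ ≤ 5L`, `L ≥ 1`. [folklore] -/
theorem final_arith₂₂ {C C₈ Z L Lam l A₁ A₂ : ℝ} (hC : 0 ≤ C) (hC₈ : 0 ≤ C₈) (hL : 1 ≤ L) (hLam1 : 1 ≤ Lam)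
    (hLam : Lam ≤ 5 * L) (hl : 0 ≤ l) (hlLam : 2 + l ≤ 2 * Lam) (hA₁0 : 0 ≤ A₁) (hA₁ : A₁ ≤ 4 * C₈ / (1 + L) ^ 15)
    (hA₂0 : 0 ≤ A₂) (hA₂ : A₂ ≤ 4 ^ 12 / L ^ 12) :
    C * Lam ^ 12 * ((Z * (2 + l)) ^ 2 * A₁ + 3 * Z ^ 2 * (2 + l) * A₂) ≤
      C * (Z ^ 2 * (16 * 5 ^ 14 * C₈ + 6 * 4 ^ 12 * 5 ^ 13)) * L := by
  have hL0 : 0 < L := by linarith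
  have hLam0 : 0 ≤ Lam := by linarith
  have h2l : (2 + l) ^ 2 ≤ (2 * Lam) ^ 2 := pow_le_pow_left₀ (by linarith) hlLam 2
  have hΛ14 : Lam ^ 14 ≤ (5 * L) ^ 14 := pow_le_pow_left₀ hLam0 hLam 14
  have hΛ13 : Lam ^ 13 ≤ (5 * L) ^ 13 := pow_le_pow_left₀ hLam0 hLam 13
  have h1L : L ^ 15 ≤ (1 + L) ^ 15 := pow_le_pow_left₀ hL0.le (by linarith) 15
  have hinvL : 1 / L ≤ L := by rw [div_le_iff₀ hL0]; nlinarith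
  -- first piece
  have p1 : Lam ^ 12 * ((Z * (2 + l)) ^ 2 * A₁) ≤ Z ^ 2 * (16 * 5 ^ 14 * C₈) * L := by
    calc Lam ^ 12 * ((Z * (2 + l)) ^ 2 * A₁) = Lam ^ 12 * (Z ^ 2 * (2 + l) ^ 2 * A₁) := by ring
      _ ≤ Lam ^ 12 * (Z ^ 2 * (2 * Lam) ^ 2 * (4 * C₈ / (1 + L) ^ 15)) := by gcongr
      _ = Z ^ 2 * (16 * C₈) * Lam ^ 14 / (1 + L) ^ 15 := by ring
      _ ≤ Z ^ 2 * (16 * C₈) * (5 * L) ^ 14 / L ^ 15 := by gcongr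
      _ = Z ^ 2 * (16 * 5 ^ 14 * C₈) * (1 / L) := by field_simp
      _ ≤ Z ^ 2 * (16 * 5 ^ 14 * C₈) * L := by gcongr
  -- second piece
  have p2 : Lam ^ 12 * (3 * Z ^ 2 * (2 + l) * A₂) ≤ Z ^ 2 * (6 * 4 ^ 12 * 5 ^ 13) * L := by
    calc Lam ^ 12 * (3 * Z ^ 2 * (2 + l) * A₂) ≤ Lam ^ 12 * (3 * Z ^ 2 * (2 * Lam) * (4 ^ 12 / L ^ 12)) := by gcongr
      _ = Z ^ 2 * (6 * 4 ^ 12) * Lam ^ 13 / L ^ 12 := by ring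
      _ ≤ Z ^ 2 * (6 * 4 ^ 12) * (5 * L) ^ 13 / L ^ 12 := by gcongr
      _ = Z ^ 2 * (6 * 4 ^ 12 * 5 ^ 13) * L := by field_simp
  calc C * Lam ^ 12 * ((Z * (2 + l)) ^ 2 * A₁ + 3 * Z ^ 2 * (2 + l) * A₂)
      = C * (Lam ^ 12 * ((Z * (2 + l)) ^ 2 * A₁) + Lam ^ 12 * (3 * Z ^ 2 * (2 + l) * A₂)) := by ring
    _ ≤ C * (Z ^ 2 * (16 * 5 ^ 14 * C₈) * L + Z ^ 2 * (6 * 4 ^ 12 * 5 ^ 13) * L) := by gcongr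
    _ = C * (Z ^ 2 * (16 * 5 ^ 14 * C₈ + 6 * 4 ^ 12 * 5 ^ 13)) * L := by ring

end Summit.Parity.GeneralizedHardyLittlewood.Theorems.MomentsBeyondDiagonal.DiagCorner

end
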